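import Literature.AlgebraicTopology.SingularHomology.SubsetCohomologyMayerVietoris
import Literature.AlgebraicTopology.SingularHomology.ExcisionTheorem
import HarnessLib

/-!
# Pull-back of the cohomology of open subsets computed in `C(X)` along a continuous map

Topic `Literature/AlgebraicTopology/SingularHomology`. A. Hatcher, *Algebraic Topology* (2002),
§3.1 p. 199 (induced homomorphisms `f* : Hⁿ(Y; G) → Hⁿ(X; G)` from the cochain maps `f^♯`),
p. 204 (Mayer–Vietoris) with §2.2 p. 150 (naturality of connecting homomorphisms); D. Husemoller,
*Fibre Bundles*, Ch. 17 §1, proof of Thm. 1.1: the maps `p* : H*(U) → H*(E_U)` for the open sets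
`U` of the base, compatible with restriction and with the Mayer–Vietoris sequences of `U`, `V` and
of `E_U`, `E_V` ("the functors `Kⁿ(U)`, `Lⁿ(U)` on the open subsets `U` of `B`").

For a continuous map `f : X → Y` and subsets `U ⊆ X`, `V ⊆ Y` with `f(U) ⊆ V` we define, in the
tree's model of the cohomology of subsets computed inside the ambient chain complexes
(`subsetCochains`, `SubsetCochains.lean`, `SubsetCohomologyMayerVietoris.lean`):

* `subsetCochains.pull f h : Hom(C_Y(V), N) → Hom(C_X(U), N)` — the dual of `f_♯ : C_X(U) → C_Y(V)`,
  and `pullH` on cohomology;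
* `subsetCochains.res_comp_pull` — compatibility with restriction (`U' ⊆ U`, `V' ⊆ V`);
* `subsetCochains.mvShortComplexPull` — the morphism of Mayer–Vietoris short complexes of
  `(A, B)` in `Y` and `(f⁻¹A, f⁻¹B)` in `X`;
* `subsetCochains.mvδ_pull` — **naturality of the Mayer–Vietoris connecting map under `f`**:
  `δ_Y ≫ pullH = pullH ≫ δ_X`.

Everything is proved; no named facts.

## References

* [HatcherAT2002] A. Hatcher, *Algebraic Topology*, CUP 2002, §3.1 pp. 199, 204; §2.2 p. 150.
* [HusemollerFibreBundles1994] D. Husemoller, *Fibre Bundles*, 3rd ed. (1994), Ch. 17 §1 Thm. 1.1.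
-/

noncomputable section

open CategoryTheory Limits

universe u v

namespace Literature.AlgebraicTopology.SingularHomology

namespace subsetCochains

variable (R : Type v) [CommRing R] (N : ModuleCat.{max u v} R) {X Y : Type u}
  [TopologicalSpace X] [TopologicalSpace Y] (f : C(X, Y))

/-- Local notation: the subcomplex `C(A) ⊆ C(Z)`. -/
local notation "𝑆" Z:arg A:arg => chainsInSub R R Z A

/-- The chain map `f_♯ : C_X(U) → C_Y(V)` of chains in subsets, for `f(U) ⊆ V`. [cite: HatcherAT2002, §2.1 (induced chain maps)] -/
abbrev pushChains {U : Set X} {V : Set Y} (h : Set.MapsTo f U V) :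
    (𝑆 X U).toComplex ⟶ (𝑆 Y V).toComplex :=
  Subcomplex.subMap (csingularChainComplex.map R R f) (𝑆 X U) (𝑆 Y V)
    (chainsInSub_le_comap_map R R f h)

/-- **Pull-back of cochains of subsets**, `f^♯ : Hom(C_Y(V), N) → Hom(C_X(U), N)` for `f(U) ⊆ V`
(Hatcher 2002, §3.1 p. 199). [cite: HatcherAT2002, §3.1 p. 199] -/
abbrev pull {U : Set X} {V : Set Y} (h : Set.MapsTo f U V) :
    subsetCochains R N V ⟶ subsetCochains R N U :=
  dualMap R N (pushChains R f h)

variable {R N}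

/-- Pushing chains commutes with the inclusions of nested subsets. [folklore] -/
lemma incl_comp_pushChains {U U' : Set X} {V V' : Set Y} (hU : U' ⊆ U) (hV : V' ⊆ V)
    (h : Set.MapsTo f U V) (h' : Set.MapsTo f U' V') :
    Subcomplex.incl (chainsInSub_mono R R hU) ≫ pushChains R f h =
      pushChains R f h' ≫ Subcomplex.incl (chainsInSub_mono R R hV) := by
  ext i x
  rfl

/-- **Pull-back commutes with restriction**: `res_Y ≫ f^♯ = f^♯ ≫ res_X` for `U' ⊆ U`,
`V' ⊆ V`. [cite: HatcherAT2002, §3.1 p. 199] -/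
theorem res_comp_pull {U U' : Set X} {V V' : Set Y} (hU : U' ⊆ U) (hV : V' ⊆ V)
    (h : Set.MapsTo f U V) (h' : Set.MapsTo f U' V') :
    res R N hV ≫ pull R N f h' = pull R N f h ≫ res R N hU := by
  change dualMap R N _ ≫ dualMap R N _ = dualMap R N _ ≫ dualMap R N _
  rw [← dualMap_comp, ← dualMap_comp, incl_comp_pushChains f hU hV h h']

/-- **Pull-back on the cohomology of subsets**, `f* : H^p_Y(V) → H^p_X(U)`. [cite: HatcherAT2002, §3.1 p. 199] -/
abbrev pullH {U : Set X} {V : Set Y} (h : Set.MapsTo f U V) (p : ℕ) :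
    (subsetCochains R N V).homology p ⟶ (subsetCochains R N U).homology p :=
  HomologicalComplex.homologyMap (pull R N f h) p

/-- `f*` commutes with restriction on cohomology. [cite: HatcherAT2002, §3.1 p. 199] -/
theorem resH_comp_pullH {U U' : Set X} {V V' : Set Y} (hU : U' ⊆ U) (hV : V' ⊆ V)
    (h : Set.MapsTo f U V) (h' : Set.MapsTo f U' V') (p : ℕ) :
    resH hV p ≫ pullH (N := N) f h' p = pullH (N := N) f h p ≫ resH hU p := by
  change HomologicalComplex.homologyMap _ p ≫ HomologicalComplex.homologyMap _ p =
    HomologicalComplex.homologyMap _ p ≫ HomologicalComplex.homologyMap _ p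
  rw [← HomologicalComplex.homologyMap_comp, ← HomologicalComplex.homologyMap_comp,
    res_comp_pull f hU hV h h']

/-! ### Mayer–Vietoris naturality under `f` -/

variable (A B : Set Y)

/-- `f` maps `f⁻¹A` into `A`. [folklore] -/
lemma mapsTo_preimage_left : Set.MapsTo f (f ⁻¹' A) A := fun _ hx ↦ hx

/-- `f` maps `f⁻¹A ∩ f⁻¹B` into `A ∩ B`. [folklore] -/
lemma mapsTo_preimage_inter : Set.MapsTo f (f ⁻¹' A ∩ f ⁻¹' B) (A ∩ B) := fun _ hx ↦ hx

/-- `f` maps `f⁻¹A ∪ f⁻¹B` into `A ∪ B`. [folklore] -/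
lemma mapsTo_preimage_union : Set.MapsTo f (f ⁻¹' A ∪ f ⁻¹' B) (A ∪ B) := fun _ hx ↦ hx

/-- `comap` of subcomplexes is monotone. [folklore] -/
lemma comap_mono' {K L : HomologicalComplex (ModuleCat.{max u v} R) (ComplexShape.down ℕ)}
    {g : K ⟶ L} {T T' : Subcomplex L} (hT : T ≤ T') : T.comap g ≤ T'.comap g := fun i x hx ↦ by
  rw [Subcomplex.mem_comap] at hx ⊢
  exact hT i hx

/-- `C(f⁻¹A) + C(f⁻¹B)` is pushed into `C(A) + C(B)`. [folklore] -/
lemma sup_preimage_le_comap :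
    𝑆 X (f ⁻¹' A) ⊔ 𝑆 X (f ⁻¹' B) ≤
      (𝑆 Y A ⊔ 𝑆 Y B).comap (csingularChainComplex.map R R f) :=
  sup_le
    ((chainsInSub_le_comap_map R R f (mapsTo_preimage_left f A)).trans (comap_mono' le_sup_left))
    ((chainsInSub_le_comap_map R R f (mapsTo_preimage_left f B)).trans (comap_mono' le_sup_right))

/-- The push of small chains `C(f⁻¹A) + C(f⁻¹B) → C(A) + C(B)`. [folklore] -/
abbrev pushChainsSup : (𝑆 X (f ⁻¹' A) ⊔ 𝑆 X (f ⁻¹' B)).toComplex ⟶ (𝑆 Y A ⊔ 𝑆 Y B).toComplex :=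
  Subcomplex.subMap (csingularChainComplex.map R R f) _ _ (sup_preimage_le_comap (R := R) f A B)

variable (R N)

/-- **The morphism of Mayer–Vietoris short complexes induced by `f`**: from that of `(A, B)` in `Y`
to that of `(f⁻¹A, f⁻¹B)` in `X`, pull-back in each term. [cite: HatcherAT2002, §3.1 p. 204] -/
abbrev mvShortComplexPull :
    mvShortComplex R N A B ⟶ mvShortComplex R N (f ⁻¹' A) (f ⁻¹' B) where
  τ₁ := dualMap R N (pushChainsSup (R := R) f A B)
  τ₂ := biprod.map (pull R N f (mapsTo_preimage_left f A)) (pull R N f (mapsTo_preimage_left f B))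
  τ₃ := pull R N f (mapsTo_preimage_inter f A B)
  comm₁₂ := by
    change dualMap R N _ ≫ biprod.lift _ _ = biprod.lift _ _ ≫ biprod.map _ _
    apply biprod.hom_ext
    · rw [Category.assoc, biprod.lift_fst, Category.assoc, biprod.map_fst, biprod.lift_fst_assoc,
        ← dualMap_comp, ← dualMap_comp]
      rfl
    · rw [Category.assoc, biprod.lift_snd, Category.assoc, biprod.map_snd, biprod.lift_snd_assoc,
        ← dualMap_comp, ← dualMap_comp]
      rfl
  comm₂₃ := by
    change biprod.map _ _ ≫ biprod.desc _ _ = biprod.desc _ _ ≫ pull R N f _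
    apply biprod.hom_ext'
    · rw [biprod.inl_map_assoc, biprod.inl_desc, biprod.inl_desc_assoc]
      exact (res_comp_pull f Set.inter_subset_left Set.inter_subset_left _ _).symm
    · rw [biprod.inr_map_assoc, biprod.inr_desc, biprod.inr_desc_assoc, Preadditive.neg_comp,
        Preadditive.comp_neg]
      exact congrArg Neg.neg (res_comp_pull f Set.inter_subset_right Set.inter_subset_right _ _).symm

variable {R N}

/-- **Naturality of the Mayer–Vietoris connecting map under a continuous map**: for open `A`,
`B ⊆ Y`, `δ_Y ≫ f* = f* ≫ δ_X` between the sequences of `(A, B)` and `(f⁻¹A, f⁻¹B)` (Hatcher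
2002, §3.1 p. 204 with §2.2 p. 150; the compatibility "`p*` commutes with the connecting maps"
in Husemoller's proof of the Leray–Hirsch theorem). [cite: HatcherAT2002, §3.1 p. 204] -/
theorem mvδ_pull (hA : IsOpen A) (hB : IsOpen B) (p : ℕ) :
    mvδ R N hA hB p ≫ pullH (N := N) f (mapsTo_preimage_union f A B) (p + 1) =
      pullH (N := N) f (mapsTo_preimage_inter f A B) p ≫
        mvδ R N (hA.preimage f.continuous) (hB.preimage f.continuous) p := by
  have hnat := HomologicalComplex.HomologySequence.δ_naturality (mvShortComplexPull R N f A B)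
    (mvShortComplex_shortExact R N A B) (mvShortComplex_shortExact R N (f ⁻¹' A) (f ⁻¹' B))
    p (p + 1) (crel p)
  haveI := isIso_homologyMap_resSup (N := N) hA hB (p + 1)
  haveI := isIso_homologyMap_resSup (N := N) (hA.preimage f.continuous) (hB.preimage f.continuous) (p + 1)
  -- the `X₁` ends, at chain level: `resSup ≫ τ₁ = pull ≫ resSup'`
  have h₀ : resSup R N A B ≫ (mvShortComplexPull R N f A B).τ₁ =
      pull R N f (mapsTo_preimage_union f A B) ≫ resSup R N (f ⁻¹' A) (f ⁻¹' B) := by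
    change dualMap R N _ ≫ dualMap R N _ = dualMap R N _ ≫ dualMap R N _
    rw [← dualMap_comp, ← dualMap_comp]
    rfl
  have h₁ : (supHomologyIso (N := N) hA hB (p + 1)).hom ≫
      pullH (N := N) f (mapsTo_preimage_union f A B) (p + 1) =
      HomologicalComplex.homologyMap (mvShortComplexPull R N f A B).τ₁ (p + 1) ≫
        (supHomologyIso (N := N) (hA.preimage f.continuous) (hB.preimage f.continuous) (p + 1)).hom := by
    change inv (HomologicalComplex.homologyMap (resSup R N A B) (p + 1)) ≫ _ =
      _ ≫ inv (HomologicalComplex.homologyMap (resSup R N (f ⁻¹' A) (f ⁻¹' B)) (p + 1))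
    rw [IsIso.inv_comp_eq, ← Category.assoc, IsIso.eq_comp_inv, ← HomologicalComplex.homologyMap_comp,
      ← HomologicalComplex.homologyMap_comp, h₀]
  rw [mvδ, mvδ, Category.assoc, h₁, ← Category.assoc, hnat, Category.assoc]

end subsetCochains

end Literature.AlgebraicTopology.SingularHomology
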